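import Literature.Computability.QuantumComplexity.CubicForrelation
import Literature.Computability.QuantumComplexity.ForrelationMemValue
import HarnessLib

/-!
# Cubic explicit `k`-fold Forrelation is in `PromiseBQP`

Topic `Literature/Computability/QuantumComplexity` (route `QuantumAdvantage/CubicForrelation`, support
item `CubicForrelationMemPromiseBQP`). The unconditional corollaries of `CubicForrelation.lean`'s
sub-promise lemmas: since explicit `k`-fold Forrelation is in `PromiseBQP`
(`AaronsonAmbainis2018_kForrelation_mem_holds`, PROVED in `ForrelationMemValue.lean`:
Aaronson–Ambainis 2018, §6 p. 26 with §3.2 Prop. 6) and `PromiseBQP` is antitone in the promise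
(`mem_PromiseBQP_of_subset`, Watrous 2009 §III.2), every cubic slice `cubicKForrelationProblem k₀`
and every exact cubic slice `exactCubicForrelationProblem k₀` is in `PromiseBQP`.

Kept in a separate file so that `CubicForrelation.lean` (definitions) does not import the
`≈ 200`-module uniform-circuit-family development behind the membership proof.

## References

* S. Aaronson, A. Ambainis, *Forrelation: a problem that optimally separates quantum from
  classical computing*, SIAM J. Comput. 47 (2018) (arXiv:1411.5729), §6 (p. 26), §3.2 Prop. 6.
* J. Watrous, *Quantum computational complexity* (2009), §III.2.
-/

noncomputable section

open Literature.Computability.Complexity Literature.Computability.Cryptography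

namespace Literature.Computability.QuantumComplexity

/-- **Cubic explicit `k₀`-fold Forrelation is in `PromiseBQP`** (every `k₀`): a sub-promise of
explicit `k`-fold Forrelation, which is in `PromiseBQP` by the proved fact
`AaronsonAmbainis2018_kForrelation_mem_holds`. [cite: AaronsonAmbainis2018, §6 (p. 26) and §3.2 Prop. 6] -/
theorem cubicKForrelationProblem_mem_PromiseBQP (k₀ : ℕ) :
    cubicKForrelationProblem k₀ ∈ PromiseBQP :=
  cubicKForrelationProblem_mem_PromiseBQP_of AaronsonAmbainis2018_kForrelation_mem_holds k₀

/-- **The exact cubic slice is in `PromiseBQP`** (every `k₀`).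
[cite: AaronsonAmbainis2018, §6 (p. 26) and §3.2 Prop. 6] -/
theorem exactCubicForrelationProblem_mem_PromiseBQP (k₀ : ℕ) :
    exactCubicForrelationProblem k₀ ∈ PromiseBQP :=
  exactCubicForrelationProblem_mem_PromiseBQP_of AaronsonAmbainis2018_kForrelation_mem_holds k₀

/-- The route's support item in its inline form: CF₂ (`k₀ = 2`) is in `PromiseBQP`.
[cite: AaronsonAmbainis2018, §6 (p. 26) and §3.2 Prop. 6] -/
theorem cubicKForrelationProblem_two_mem_PromiseBQP :
    (⟨KForrelationInstance.encode '' {I | I.IsYes ∧ I.k = 2 ∧ Even I.n ∧ ∀ i,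
        ∃ p : MvPolynomial (Fin I.n) (ZMod 2), p.totalDegree ≤ 3 ∧ ∀ x, (I.C i).eval x =
          decide (MvPolynomial.eval (fun j => if x j then (1 : ZMod 2) else 0) p = 1)},
      KForrelationInstance.encode '' {I | I.IsNo ∧ I.k = 2 ∧ Even I.n ∧ ∀ i,
        ∃ p : MvPolynomial (Fin I.n) (ZMod 2), p.totalDegree ≤ 3 ∧ ∀ x, (I.C i).eval x =
          decide (MvPolynomial.eval (fun j => if x j then (1 : ZMod 2) else 0) p = 1)}⟩ :
      PromiseProblem) ∈ PromiseBQP :=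
  cubicKForrelationProblem_mem_PromiseBQP 2

end Literature.Computability.QuantumComplexity

end
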